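import Summits.ResolutionOfSingularities.ResolutionOfSingularities.Theorems.HomologicalConductorSurfaceTerminationGenusChart
import Summits.ResolutionOfSingularities.ResolutionOfSingularities.Theorems.HomologicalConductorSurfaceTerminationGenusCover
import Summits.ResolutionOfSingularities.ResolutionOfSingularities.Theorems.HomologicalConductorSurfaceTerminationGenusTwoRegularLeray
import Summits.ResolutionOfSingularities.ResolutionOfSingularities.Theorems.HomologicalConductorSurfaceTerminationGoodCover
import Summits.ResolutionOfSingularities.ResolutionOfSingularities.Theorems.HomologicalConductorNoZenoStageRational
import Literature.AlgebraicGeometry.Resolution.Lipman1969DominationByQuadraticTransforms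
import Literature.AlgebraicGeometry.Resolution.Lipman1969H1Domination
import Literature.AlgebraicGeometry.CossartPiltant200819.Thm11ProjectiveIntegral2019
import Literature.AlgebraicGeometry.Resolution.ChowLemmaRing
import Literature.AlgebraicGeometry.Resolution.SandwichedWeakPatching
import Literature.AlgebraicGeometry.Resolution.MinimalResolutionIsoOverRegularLocus
import Literature.AlgebraicGeometry.Morphisms.IsoOverOpen
import HarnessLib

/-!
# Crux `NoZenoR` (stmt-ResolutionOfSingularities-19943) — Lipman (1.2) 1) over a REGULAR base MODULO statement B):
# the stage-rationality feed `hasRationalSingularity_of_isLocalization` with `Lipman1969_1_2` replaced by `Lipman1969_1_2_B`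

Route `ResolutionOfSingularities/HomologicalConductor` (cell decomp-res, hand leafhand-res-homologicalconduct-12 g1).
OURS: AI-written, weaker than expert review; nothing here is a statement of the manuscript under review (Hironaka 2017).
SUPPORT level (`--supports stmt-19943`), counted 0.  Def-free.  The only named fact is the HYPOTHESIS
`(hB : Lipman1969_1_2_B)` (statement B) of Lipman's proof of (1.2) = a special case of Zariski's Theorem (26.1); typed by
hand leafhand-res-homologicalconduct-11, `Resolution/Lipman1969DominationByQuadraticTransforms`).

* `hasTrivialCechH1_pullback_snd_fromSpecStalk_of_B` — (L1) mod B): `Ȟ¹ = 0` on `Z ×_X Spec 𝒪_{X,x}` for a proper birational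
  `ρ : Z → X` (`Z` regular) at a REGULAR point `x` of dimension `≤ 2` (the dimension-two case is Lipman (1.2) 2) for the
  regular = rational `𝒪_{X,x}`, i.e. `Lipman1969_1_2_B.hasTrivialCechH1_of_isResolution`).
* `hasRationalSingularity_of_chart_of_forall_stalk` — the cohomological core of (1.2) 1) over a PROJECTIVE model
  (`…NoZenoRationalAscentProjective`) with the mixed-piece acyclicity replaced by the POINTWISE vanishing of `Ȟ¹` at the
  points of the overlaps `W_{a₀} ∩ W_b` ((L2) `GenusDescent.cechZ1_le_cechB1_chart_of_forall_stalk_mem`).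
* `hasRationalSingularity_stalk_of_regular_off_point_of_B` — Lipman (1.2) 1) at a CLOSED point `w` of a projective
  birational model `W → Spec R` of a REGULAR two-dimensional `R`, all of whose OTHER points in some neighbourhood are regular,
  MODULO B): `𝒪_{W,w}` has a rational singularity.

What is NOT here: the last transport `𝒪_{W*,w} ≃ B_𝔮` for the affine model `Spec B ↪ W*` of `…RationalAscentProjectiveModel`
(the drop-in for `NoZeno.SandwichCluster.hasRationalSingularity_of_isLocalization` itself), see the hand's report.
No crux, kill test or summit statement is proved; resolution of singularities in positive characteristic is NOT proved.

## References
* J. Lipman, *Rational singularities …*, Publ. Math. IHÉS 36 (1969): Prop. (1.2) and its proof, p. 200 with footnote (1);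
  statement B) (p. 200); Theorem (26.1) (p. 274). [Lipman1969]
* U. Görtz, T. Wedhorn, *Algebraic Geometry II* (2023): Cor. 21.82, Lemma 22.1, Cor. 24.44. [GortzWedhorn2023]
* A. Grothendieck, EGA III₁ (1961): (1.4.15), (4.2.2). [EGAIII1]
-/

noncomputable section

-- single-problem summit: the doubled namespace component `ResolutionOfSingularities` is forced
set_option linter.dupNamespace false

namespace Summit.ResolutionOfSingularities.ResolutionOfSingularities.Theorems.NoZeno.RationalAscent

open CategoryTheory CategoryTheory.Limits AlgebraicGeometry TopologicalSpace IsLocalRing Opposite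
open Literature.AlgebraicGeometry.Resolution Literature.AlgebraicGeometry.Morphisms
open Summit.ResolutionOfSingularities.ResolutionOfSingularities.Theorems.SurfaceTermination.GenusDescent
open Summit.ResolutionOfSingularities.ResolutionOfSingularities.Theorems.NoZeno.SandwichCluster

/-! ## (L1) modulo B): pointwise vanishing at regular points of dimension `≤ 2` -/

/-- **(L1) mod B)**: for `ρ : Z → X` proper birational with `Z` regular, `X` integral and locally Noetherian, and a REGULAR
point `x` of dimension `≤ 2`, `Ȟ¹ = 0` on the base change `Z ×_X Spec 𝒪_{X,x} → Spec 𝒪_{X,x}` — the dimension-two case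
being Lipman (1.2) 2) for the rational (regular) `𝒪_{X,x}` modulo statement B)
(`Lipman1969_1_2_B.hasTrivialCechH1_of_isResolution`). [cite: Lipman1969, Proposition (1.2) 2), proof p. 200, statement B)] -/
theorem hasTrivialCechH1_pullback_snd_fromSpecStalk_of_B (hB : Lipman1969_1_2_B.{0})
    {X Z : Scheme.{0}} [IsIntegral X] [IsLocallyNoetherian X] [NoetherianSpace X] [NoetherianSpace Z]
    (ρ : Z ⟶ X) [IsProper ρ] (x : X) (hρ : IsBirational ρ) (hZ : Scheme.IsRegular Z)
    (hx : IsRegularLocalRing (X.presheaf.stalk x)) (hdim : ringKrullDim (X.presheaf.stalk x) ≤ 2) :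
    HasTrivialCechH1 (pullback.snd ρ (X.fromSpecStalk x)) := by
  refine hasTrivialCechH1_pullback_snd_fromSpecStalk_of_dimTwo ρ x hρ hZ hx hdim fun h2 => ?_
  obtain ⟨hres, _⟩ := isResolution_pullback_snd_fromSpecStalk ρ x hρ hZ
  haveI := hx
  haveI : IsIntegrallyClosed (X.presheaf.stalk x) := isIntegrallyClosed_of_isRegularLocalRing _
  exact Lipman1969_1_2_B.hasTrivialCechH1_of_isResolution hB h2
    (hasRationalSingularity_of_isRegularLocalRing _) _ hres

/-! ## The core over a projective model, pointwise form of the mixed-piece hypothesis -/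

/-- **Lipman (1.2) 1), cohomological core over a PROJECTIVE model, POINTWISE mixed-piece hypothesis.**  As
`hasRationalSingularity_of_chart_of_isProjectiveOverRing` (`…NoZenoRationalAscentProjective`), with the acyclicity of the
mixed pieces replaced by: for `b ≠ a₀` and every `x ∈ W_{a₀} ∩ W_b`, `Ȟ¹ = 0` on `Z ×_B Spec 𝒪_{B,x} → Spec 𝒪_{B,x}`
((L2) local-to-global on the affine overlap, `GenusDescent.cechZ1_le_cechB1_chart_of_forall_stalk_mem`).
[cite: Lipman1969, Proposition (1.2) 1), proof p. 200 with footnote (1)] [cite: GortzWedhorn2023, Cor. 21.82, Cor. 24.44]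
[cite: EGAIII1, Prop. (1.4.15)] -/
theorem hasRationalSingularity_of_chart_of_forall_stalk
    {T : Type} [CommRing T] [IsDomain T] [IsNoetherianRing T] [IsLocalRing T]
    (hdimT : ringKrullDim T ≤ 2)
    {Z : Scheme.{0}} {B : Scheme.{0}} [IsIntegral B] (gB : B ⟶ Spec (.of T)) [IsProper gB] (hgB : IsBirational gB)
    (hproj : Literature.AlgebraicGeometry.Crystalline.IsProjectiveOverRing
      (CategoryTheory.Over.mk gB : Literature.AlgebraicGeometry.Motives.SchemeOver T))
    (σB : Z ⟶ B) [IsProper σB] (hZ : HasTrivialCechH1 (σB ≫ gB))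
    {α : Type} (W : α → B.Opens) (hW : ∀ a, IsAffineOpen (W a)) (hWcov : ⨆ a, W a = ⊤) (a₀ : α)
    (hpt : ∀ b, b ≠ a₀ → ∀ x ∈ W a₀ ⊓ W b, HasTrivialCechH1 (pullback.snd σB (B.fromSpecStalk x)))
    {N : Type} [CommRing N] [IsDomain N] [Algebra T N]
    (σ : ((σB ⁻¹ᵁ W a₀ : Z.Opens) : Scheme.{0}) ⟶ Spec (.of N)) (hσ : IsResolution σ)
    (hσT : (σB ⁻¹ᵁ W a₀).ι ≫ (σB ≫ gB) = σ ≫ Spec.map (CommRingCat.ofHom (algebraMap T N)))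
    (T' : Type) [CommRing T'] [IsDomain T'] [Algebra N T'] (M : Submonoid N) [IsLocalization M T'] :
    HasRationalSingularity T' := by
  classical
  haveI : IsNoetherianRing (CommRingCat.of T) := ‹IsNoetherianRing T›
  haveI : IsLocalRing (CommRingCat.of T) := ‹IsLocalRing T›
  haveI : IsLocallyNoetherian Z := LocallyOfFiniteType.isLocallyNoetherian (σB ≫ gB)
  haveI : CompactSpace Z := QuasiCompact.compactSpace_of_compactSpace (σB ≫ gB)
  haveI : IsNoetherian Z := {}
  haveI : Z.IsSeparated := ⟨by rw [← terminal.comp_from (σB ≫ gB)]; infer_instance⟩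
  -- fibres of `B → Spec T` have dimension `≤ 1`
  have hfib : ∀ y : Spec (.of T), topologicalKrullDim (gB.fiber y) ≤ 1 :=
    topologicalKrullDim_fiber_le_one_of_isBirational hdimT hgB
  -- a finite affine cover `𝒰` of `Z` refining `σ_B⁻¹𝒲`
  obtain ⟨ι, _, U, r, hUaff, hUr, hUcov⟩ := exists_finite_affine_refinement Z
    (fun a => σB ⁻¹ᵁ W a) (by rw [← Scheme.Hom.preimage_iSup, hWcov]; exact Opens.map_top _)
  -- the mixed pieces `(U_i ∩ σ_B⁻¹(W_{a₀} ∩ W_b))_i` are acyclic, by (L2) from the pointwise vanishing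
  have hvan : ∀ b, b ≠ a₀ →
      cechZ1 (σB ≫ gB) (fun i => U i ⊓ σB ⁻¹ᵁ (W a₀ ⊓ W b)) ≤
        cechB1 (σB ≫ gB) (fun i => U i ⊓ σB ⁻¹ᵁ (W a₀ ⊓ W b)) := by
    intro b hb
    have hC : IsAffineOpen (W a₀ ⊓ W b) :=
      haveI : B.IsSeparated := ⟨by rw [← terminal.comp_from gB]; infer_instance⟩
      (hW a₀).inf (hW b)
    refine cechZ1_le_cechB1_chart_of_forall_stalk_mem gB σB (hpt b hb) hC _ ?_ ?_ ?_ ?_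
    · rw [← iSup_inf_eq, hUcov, top_inf_eq]
    · exact fun j => SeparatedAffinePreimage.isAffineOpen_inf_preimage σB gB (hUaff j) hC
    · intro j j'
      rw [inf_inf_inf_inf_eq]
      exact SeparatedAffinePreimage.isAffineOpen_inf_preimage σB gB ((hUaff j).inf (hUaff j')) hC
    · intro j j' j''
      rw [inf_inf_inf_inf_inf_eq]
      exact SeparatedAffinePreimage.isAffineOpen_inf_preimage σB gB
        (((hUaff j).inf (hUaff j')).inf (hUaff j'')) hC
  -- GLUE over the projective middle model: `ℓ_T Ȟ¹((U_i ∩ σ_B⁻¹W_{a₀})_i) ≤ ℓ_T Ȟ¹(𝒰)`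
  have hglue : Module.length T (CechH1 (σB ≫ gB) (fun i => U i ⊓ σB ⁻¹ᵁ W a₀)) ≤
      Module.length T (CechH1 (σB ≫ gB) U) :=
    (cechRefineH1_preimage_piece_surjective_of_isProjectiveOverRing' gB hproj (hfib (closedPoint T)) σB
      (σB ≫ gB) rfl W hW hWcov U r hUr hUcov a₀ hvan).2
  -- `H¹(Z, 𝒪_Z) = 0` on the finite affine cover `𝒰`
  have h0 : Module.length T (CechH1 (σB ≫ gB) U) = 0 := by
    haveI := hZ ι U hUaff hUcov
    exact Module.length_eq_zero
  -- the chart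
  obtain ⟨X', f', hf', hX'⟩ := exists_isResolution_length_cechH1_le_of_chart (σB ≫ gB) U hUaff hUcov
    (σB ⁻¹ᵁ W a₀) (fun O hO => SeparatedAffinePreimage.isAffineOpen_inf_preimage σB gB hO (hW a₀))
    σ hσ hσT T' M
  refine ⟨X', f', hf', fun ι' _ U' hU' hU'cov => ?_⟩
  have hle : Module.length T' (CechH1 f' U') ≤ 0 := by
    calc Module.length T' (CechH1 f' U')
        ≤ Module.length T (CechH1 (σB ≫ gB) (fun i => U i ⊓ σB ⁻¹ᵁ W a₀)) := hX' ι' U' hU' hU'cov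
      _ ≤ Module.length T (CechH1 (σB ≫ gB) U) := hglue
      _ = 0 := h0
  exact Module.length_eq_zero_iff.mp (nonpos_iff_eq_zero.mp hle)

/-! ## Lipman (1.2) 1) at a closed point of a projective model of a regular surface germ, modulo B) -/

/-- **Lipman (1.2) 1) over a REGULAR base, at a closed point with regular punctured neighbourhood, MODULO statement B).**
`R` a regular local ring of dimension `2`; `g_W : W → Spec R` proper birational with `W` integral and PROJECTIVE over `R`;
`w ∈ W` a CLOSED point with an open neighbourhood `V` all of whose points other than `w` are regular.  Then `𝒪_{W,w}` has a
rational singularity.  Proof (Lipman p. 200 with footnote (1), Čech form): B) applied to a desingularization of `Spec R`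
gives `h : Z → W` with `Z → Spec R` a desingularization, so `H¹(Z, 𝒪_Z) = 0` ((1.2) 2) mod B) for the rational = regular `R`);
the «good cover» `{W₀} ∪ {W_b ⊆ W ∖ {w}}` of an affine `W₀ ∋ w` inside `V` has its overlaps made of regular points of
dimension `≤ 2`, where `R¹h_*𝒪_Z = 0` stalkwise ((L1) mod B)); the core over the projective `W` and the chart
`h⁻¹W₀ → W₀ ≅ Spec Γ(W, W₀)` localised at `w` conclude.
[cite: Lipman1969, Proposition (1.2) 1), proof p. 200 with footnote (1); statement B) (p. 200)]
[cite: GortzWedhorn2023, Cor. 21.82, Cor. 24.44] [cite: EGAIII1, Prop. (1.4.15)] -/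
theorem hasRationalSingularity_stalk_of_regular_off_point_of_B (hB : Lipman1969_1_2_B.{0})
    {R : Type} [CommRing R] [IsDomain R] [IsRegularLocalRing R] (hdimR : ringKrullDim R = 2)
    -- the projective birational model
    {W : Scheme.{0}} [IsIntegral W] (gW : W ⟶ Spec (.of R)) [IsProper gW] (hbir : IsBirational gW)
    (hproj : Literature.AlgebraicGeometry.Crystalline.IsProjectiveOverRing
      (CategoryTheory.Over.mk gW : Literature.AlgebraicGeometry.Motives.SchemeOver R))
    -- the closed point and its punctured-regular neighbourhood
    (w : W) (hw : IsClosed ({w} : Set W)) (V : W.Opens) (hwV : w ∈ V)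
    (hreg : ∀ x ∈ V, x ≠ w → IsRegularLocalRing (W.presheaf.stalk x)) :
    HasRationalSingularity (W.presheaf.stalk w) := by
  classical
  haveI : IsNoetherianRing (CommRingCat.of R) := (inferInstance : IsNoetherianRing R)
  haveI : IsLocalRing (CommRingCat.of R) := (inferInstance : IsLocalRing R)
  haveI : IsDomain (CommRingCat.of R) := ‹IsDomain R›
  haveI : IsIntegrallyClosed R := isIntegrallyClosed_of_isRegularLocalRing R
  haveI : W.IsSeparated := ⟨by rw [← terminal.comp_from gW]; infer_instance⟩
  haveI : IsLocallyNoetherian W := LocallyOfFiniteType.isLocallyNoetherian gW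
  haveI : CompactSpace W := QuasiCompact.compactSpace_of_compactSpace gW
  haveI : IsNoetherian W := {}
  -- a desingularization of `Spec R` (the regular `R` is a rational singularity) and statement B)
  have hratR : HasRationalSingularity R := hasRationalSingularity_of_isRegularLocalRing R
  obtain ⟨X, fX, hfX, -⟩ := hratR
  obtain ⟨Z, jZ, h, hjZ, hfac⟩ := hB R hdimR X fX hfX W gW hbir
  haveI : IsProper jZ := hjZ.isProper
  haveI : IsProper fX := hfX.isProper
  have hres : IsResolution (jZ ≫ fX) := ⟨inferInstance, hjZ.isBirational.comp hfX.isBirational, hjZ.isRegular⟩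
  -- `H¹(Z, 𝒪_Z) = 0`: (1.2) 2) modulo B) for the rational `R`
  have hZ0 : HasTrivialCechH1 (jZ ≫ fX) :=
    Lipman1969_1_2_B.hasTrivialCechH1_of_isResolution hB hdimR (hasRationalSingularity_of_isRegularLocalRing R) _ hres
  have hZ : HasTrivialCechH1 (h ≫ gW) := by rw [hfac]; exact hZ0
  haveI : IsProper (h ≫ gW) := by rw [hfac]; infer_instance
  haveI : IsProper h := IsProper.of_comp h gW
  haveI : IsIntegral Z := hres.isIntegral_source
  haveI : IsLocallyNoetherian Z := LocallyOfFiniteType.isLocallyNoetherian (h ≫ gW)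
  haveI : CompactSpace Z := QuasiCompact.compactSpace_of_compactSpace (h ≫ gW)
  haveI : IsNoetherian Z := {}
  have hbirh : IsBirational h :=
    isBirational_of_comp' hbir (by rw [hfac]; exact hres.isBirational)
  have hZreg : Scheme.IsRegular Z := hjZ.isRegular
  -- local dimensions on `W` are `≤ 2`
  have hdimW : ∀ x : W, ringKrullDim (W.presheaf.stalk x) ≤ 2 := fun x =>
    ringKrullDim_stalk_le_two_of_isBirational hdimR.le gW hbir x
  -- an affine `W₀ ∋ w` inside `V`, and the good cover `{W₀} ∪ {W_b ⊆ W ∖ {w}}`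
  obtain ⟨W₀, hW₀, hwW₀, hW₀V⟩ := (Opens.isBasis_iff_nbhd.mp W.isBasis_affineOpens) hwV
  obtain ⟨α, _, a₀, Wc, hWa₀, hWaff, hWcov, hdisj⟩ := exists_affineCover_eq_and_disjoint W₀ hW₀ {w}
    (Set.finite_singleton w) (fun p hp => by rw [Set.mem_singleton_iff.mp hp]; exact hw)
    (Set.singleton_subset_iff.mpr hwW₀)
  subst hWa₀
  have hW₀' : IsAffineOpen (Wc a₀) := hWaff a₀
  -- the overlaps consist of regular points of dimension `≤ 2`: pointwise vanishing there, (L1) mod B)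
  have hpt : ∀ b, b ≠ a₀ → ∀ x ∈ Wc a₀ ⊓ Wc b, HasTrivialCechH1 (pullback.snd h (W.fromSpecStalk x)) := by
    intro b hb x hx
    have hxw : x ≠ w := fun hxw =>
      Set.disjoint_left.mp (hdisj b hb) (Set.mem_singleton_iff.mpr hxw) hx.2
    exact hasTrivialCechH1_pullback_snd_fromSpecStalk_of_B hB h x hbirh hZreg (hreg x (hW₀V hx.1) hxw) (hdimW x)
  -- the chart `σ : h⁻¹W₀ → W₀ ≅ Spec Γ(W, W₀)` and its structure map over `R`
  let N : Type := Γ(W, Wc a₀)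
  haveI : Nonempty ↥(Wc a₀) := ⟨⟨w, hwW₀⟩⟩
  let φ : CommRingCat.of R ⟶ Γ(W, Wc a₀) := Spec.preimage (hW₀'.fromSpec ≫ gW)
  letI : Algebra R N := φ.hom.toAlgebra
  let σ : ((h ⁻¹ᵁ Wc a₀ : Z.Opens) : Scheme.{0}) ⟶ Spec (.of N) := (h ∣_ Wc a₀) ≫ hW₀'.isoSpec.hom
  have hσ : IsResolution σ := by
    have h1 : IsResolution (h ∣_ Wc a₀) := IsResolution.morphismRestrict ⟨inferInstance, hbirh, hZreg⟩ (Wc a₀)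
    haveI := h1.isProper
    exact ⟨inferInstance, h1.isBirational.comp_iso _, h1.isRegular⟩
  have hσT : (h ⁻¹ᵁ Wc a₀).ι ≫ (h ≫ gW) = σ ≫ Spec.map (CommRingCat.ofHom (algebraMap R N)) := by
    have h1 : Spec.map (CommRingCat.ofHom (algebraMap R N)) = hW₀'.fromSpec ≫ gW := by
      change Spec.map φ = _
      exact Spec.map_preimage _
    rw [h1, ← hW₀'.isoSpec_inv_ι]
    simp only [σ, Category.assoc, Iso.hom_inv_id_assoc]
    rw [← Category.assoc (h ∣_ Wc a₀), morphismRestrict_ι, Category.assoc]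
  -- the local ring at `w` is a localisation of the chart ring
  haveI : Nonempty ↥((Wc a₀ : W.Opens) : Scheme.{0}) := ⟨(⟨w, hwW₀⟩ : Wc a₀)⟩
  haveI : IsDomain N := IsIntegral.component_integral (Wc a₀)
  letI : Algebra N (W.presheaf.stalk w) := W.presheaf.algebra_section_stalk (⟨w, hwW₀⟩ : Wc a₀)
  haveI : IsLocalization.AtPrime (W.presheaf.stalk w) (hW₀'.primeIdealOf ⟨w, hwW₀⟩).asIdeal :=
    hW₀'.isLocalization_stalk ⟨w, hwW₀⟩
  exact hasRationalSingularity_of_chart_of_forall_stalk hdimR.le gW hbir hproj h hZ Wc hWaff hWcov a₀ hpt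
    σ hσ hσT (W.presheaf.stalk w) (hW₀'.primeIdealOf ⟨w, hwW₀⟩).asIdeal.primeCompl

end Summit.ResolutionOfSingularities.ResolutionOfSingularities.Theorems.NoZeno.RationalAscent

end
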